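import Literature.NumberTheory.LFunctions.WeilBlockRowsP
import HarnessLib

/-!
# Row-wise block checks with a factored change of basis and a materialized Bessel block

Topic: `Literature/NumberTheory/LFunctions`. A second cost reduction for the row-wise dominance check of a
Weil certificate (`WeilCert.checkDomRow`, `WeilBlockRows.lean`; materialized `P_r`: `WeilBlockRowsP.lean`).
For `nb ≈ 75` the exact inverse `D = C⁻¹` of the Legendre change of basis has denominators of ~90 digits, and
the Gram matrix `H` of the monomials has odd denominators; summing `nb` such fractions per entry makes every
row of `R = S' − UᵀU` a computation with repeated 200-digit gcds, above one declaration's kernel budget.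
Here the certificate supplies, as DATA,

* a factored inverse `D_{ki} = Dn_{ki} / Ls_i` (`Dn` integral in practice, one scale per column) — claim rows
  `WeilCert.checkDnRow`;
* the Bessel block `Hp = C H Cᵀ` (diagonal for the Legendre `C`) — claim rows `WeilCert.checkHpRow`;

and the row of `R` is computed as
`r_j = (Σ_l (Σ_k Dn_{ki} Pm_{kl}) Dn_{lj}) / (Ls_i Ls_j) + κ (2 b_i [i = j] − b_i b_j Hp_{ij}) − Σ_k U_{ki} U_{kj}`
(`WeilCert.rRowPZ`, `WeilCert.checkDomRowPZ`), all sums being over dyadic/integral data.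
**`WeilCert.checkDomRow_of_PZ`**: the three families of claim rows and `checkDomRowPZ` give `checkDomRow`,
so `WeilCert.checkBlockK_of_rows` applies unchanged. Pure bookkeeping; everything here is proved.
-/

noncomputable section

open Finset
open scoped BigOperators

namespace Literature.NumberTheory.LFunctions

namespace WeilCert

variable (c : WeilCert)

/-- Row `k` of the claim "`D_{ki} = Dn_{ki} / Ls_i`" (factored inverse change of basis), for all `i < nb`,
with non-zero scales. [folklore] -/
def checkDnRow (Dn : List (List ℚ)) (Ls : List ℚ) (p k : ℕ) : Bool :=
  allBelow c.nb fun i ↦ decide (getV Ls i ≠ 0 ∧ getM (c.Db p) k i = getM Dn k i / getV Ls i)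

/-- Row `i` of the claim "`Hp = C H Cᵀ`" (the Bessel block `hpBlk`), for all `j < nb`. [folklore] -/
def checkHpRow (Hp : List (List ℚ)) (p i : ℕ) : Bool :=
  allBelow c.nb fun j ↦ decide (getM Hp i j = sumR c.nb fun l ↦ getV (c.chRow p i) l * getM (c.Cb p) j l)

/-- Row `i` of the unscaled product `Dnᵀ Pm`: `w'_l = Σ_k Dn_{ki} Pm_{kl}`. [folklore] -/
def dtpRowPZ (Pm Dn : List (List ℚ)) (i : ℕ) : List ℚ :=
  tabV c.nb fun l ↦ sumR c.nb fun k ↦ getM Dn k i * getM Pm k l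

/-- Row `i` of `R = S' − UᵀU` from the materialized block, the factored inverse and the Bessel block. [folklore] -/
def rRowPZ (Pm Dn : List (List ℚ)) (Ls : List ℚ) (Hp : List (List ℚ)) (κ : ℚ) (p i : ℕ) : List ℚ :=
  let w := c.dtpRowPZ Pm Dn i
  tabV c.nb fun j ↦
    ((sumR c.nb fun l ↦ getV w l * getM Dn l j) / (getV Ls i * getV Ls j) +
        κ * ((if i = j then 2 * c.bQ p i else 0) - c.bQ p i * c.bQ p j * getM Hp i j)) -
      sumR c.nb fun k ↦ getM (c.Ub p) k i * getM (c.Ub p) k j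

/-- One-sided dominance of row `i` of `R`, factored form. [folklore] -/
def checkDomRowPZ (Pm Dn : List (List ℚ)) (Ls : List ℚ) (Hp : List (List ℚ)) (κ : ℚ) (p i : ℕ) : Bool :=
  let r := c.rRowPZ Pm Dn Ls Hp κ p i
  decide ((sumR c.nb fun j ↦ if j = i then 0 else |getV r j|) ≤ getV r i)

variable {c}

/-- A checked `Dn` claim row gives the entries of `D` and non-zero scales. [folklore] -/
theorem getM_Db_of_checkDnRow {Dn : List (List ℚ)} {Ls : List ℚ} {p k : ℕ}
    (h : c.checkDnRow Dn Ls p k = true) {i : ℕ} (hi : i < c.nb) :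
    getV Ls i ≠ 0 ∧ getM (c.Db p) k i = getM Dn k i / getV Ls i := by
  unfold checkDnRow at h
  have := of_allBelow h hi
  rwa [decide_eq_true_eq] at this

/-- A checked `Hp` claim row gives the entries of `C H Cᵀ`. [folklore] -/
theorem getM_Hp_of_checkHpRow {Hp : List (List ℚ)} {p i : ℕ}
    (h : c.checkHpRow Hp p i = true) {j : ℕ} (hj : j < c.nb) :
    getM Hp i j = sumR c.nb fun l ↦ getV (c.chRow p i) l * getM (c.Cb p) j l := by
  unfold checkHpRow at h
  have := of_allBelow h hj
  rwa [decide_eq_true_eq] at this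

/-- The unscaled row, rescaled, is the materialized `Dᵀ Pm` row: `w_l = w'_l / Ls_i`. [folklore] -/
theorem getV_dtpRowP_eq {Pm Dn : List (List ℚ)} {Ls : List ℚ} {p : ℕ}
    (hDn : ∀ k < c.nb, c.checkDnRow Dn Ls p k = true) {i : ℕ} (hi : i < c.nb) {l : ℕ} (hl : l < c.nb) :
    getV (c.dtpRowP Pm p i) l = getV (c.dtpRowPZ Pm Dn i) l / getV Ls i := by
  unfold dtpRowP dtpRowPZ
  rw [getV_tabV _ hl, getV_tabV _ hl, sumR_eq_sum, sumR_eq_sum, Finset.sum_div]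
  refine Finset.sum_congr rfl fun k hk ↦ ?_
  rw [(getM_Db_of_checkDnRow (hDn k (Finset.mem_range.1 hk)) hi).2]
  ring

/-- With all claim rows checked, the factored row of `R` is the materialized-`P` row. [folklore] -/
theorem getV_rRowPZ_eq {Pm Dn : List (List ℚ)} {Ls : List ℚ} {Hp : List (List ℚ)} {p : ℕ}
    (hDn : ∀ k < c.nb, c.checkDnRow Dn Ls p k = true) (hHp : ∀ i < c.nb, c.checkHpRow Hp p i = true)
    (κ : ℚ) {i : ℕ} (hi : i < c.nb) {j : ℕ} (hj : j < c.nb) :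
    getV (c.rRowPZ Pm Dn Ls Hp κ p i) j = getV (c.rRowP Pm κ p i) j := by
  unfold rRowPZ rRowP
  dsimp only
  rw [getV_tabV _ hj, getV_tabV _ hj]
  have hLi := fun k (hk : k < c.nb) ↦ (getM_Db_of_checkDnRow (hDn k hk) hi).1
  have hLj := fun k (hk : k < c.nb) ↦ (getM_Db_of_checkDnRow (hDn k hk) hj).1
  have hnb : 0 < c.nb := lt_of_le_of_lt (Nat.zero_le i) hi
  have hLi0 : getV Ls i ≠ 0 := hLi 0 hnb
  have hLj0 : getV Ls j ≠ 0 := hLj 0 hnb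
  congr 1
  congr 1
  · -- the `Dᵀ Pm D` entry
    rw [sumR_eq_sum, sumR_eq_sum, Finset.sum_div]
    refine Finset.sum_congr rfl fun l hl ↦ ?_
    have hl' := Finset.mem_range.1 hl
    rw [getV_dtpRowP_eq hDn hi hl', (getM_Db_of_checkDnRow (hDn l hl') hj).2]
    field_simp
  · -- the Bessel entry
    rw [getM_Hp_of_checkHpRow (hHp i hi) hj]

/-- **`checkDomRow` from the factored data.** [folklore] -/
theorem checkDomRow_of_PZ {nu : List ℚ} {Pm Dn : List (List ℚ)} {Ls : List ℚ} {Hp : List (List ℚ)} {κ : ℚ}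
    {p i : ℕ} (hi : i < c.nb)
    (hPm : ∀ k < c.nb, c.checkPmRow nu Pm p k = true) (hDn : ∀ k < c.nb, c.checkDnRow Dn Ls p k = true)
    (hHp : ∀ i < c.nb, c.checkHpRow Hp p i = true) (h : c.checkDomRowPZ Pm Dn Ls Hp κ p i = true) :
    c.checkDomRow nu κ p i = true := by
  refine checkDomRow_of_P hPm ?_
  unfold checkDomRowPZ at h
  unfold checkDomRowP
  dsimp only at h ⊢
  rw [decide_eq_true_eq] at h ⊢
  rw [sumR_eq_sum] at h ⊢
  have hdiag := getV_rRowPZ_eq (Pm := Pm) hDn hHp κ hi hi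
  rw [hdiag] at h
  refine le_trans (le_of_eq ?_) h
  refine Finset.sum_congr rfl fun j hj ↦ ?_
  by_cases hji : j = i
  · rw [if_pos hji, if_pos hji]
  · rw [if_neg hji, if_neg hji, getV_rRowPZ_eq (Pm := Pm) hDn hHp κ hi (Finset.mem_range.1 hj)]

end WeilCert

end Literature.NumberTheory.LFunctions
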